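import Literature.NumberTheory.LFunctions.ClassicalPsiErrorTerm
import Literature.NumberTheory.LFunctions.ZetaClassicalRegionBounds
import Literature.NumberTheory.LFunctions.MertensOneSided
import HarnessLib

/-!
# `M(x) = ∑_{n ≤ x} μ(n) ≪ x exp(-c √log x)` (de la Vallée-Poussin–Landau)

Topic `Literature/NumberTheory/LFunctions` (trunk T-ANT). Everything in this file is PROVED.

The classical estimate for the summatory function of the Möbius function,
`|∑_{n ≤ x} μ(n)| ≤ C x exp(-c √log x)` (`x ≥ 2`) for some absolute `c > 0`, `C`
(`Literature.NumberTheory.LFunctions.abs_sum_moebius_le_mul_exp_neg_sqrt_log`; Landau 1908, Montgomery–Vaughan §6.2,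
Titchmarsh §3.11 in the de la Vallée-Poussin region), obtained from the tree as follows:

* the classical `ψ`-machinery `Literature.NumberTheory.LFunctions.ClassicalPsiData.abs_psi_sub_le` (`ClassicalPsiErrorTerm.lean`,
  Landau's 1903 Riesz-mean contour argument, Montgomery–Vaughan Thm. 6.9) applies to ANY nonnegative
  sequence `Λ'` whose Dirichlet series is `1/(s-1) + F(s)` with `F` holomorphic and
  `≪ log(|t|+4)` on a region `σ > 1 - c/log(|t|+4)`;
* we take `Λ'(n) = 1 + μ(n) ∈ {0, 1, 2}`: its Dirichlet series is `ζ(s) + 1/ζ(s) = 1/(s-1) + F(s)`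
  with `F = ζ₀ + ζ⁻¹`, `ζ₀(s) = ζ(s) - 1/(s-1)` (Mathlib's entire `riemannZeta₀`) and `ζ⁻¹` with the
  removable singularity at `s = 1` filled in (`Literature.NumberTheory.LFunctions.MertensBoundRH.zetaInv`, holomorphic at `1` and
  wherever `ζ ≠ 0`: `Literature.NumberTheory.LFunctions.differentiableAt_zetaInv`);
* the zero-freeness of `ζ` and the bounds `ζ(s) - 1/(s-1) ≪ log(|t|+3)`, `1/ζ(s) ≪ log(|t|+3)` on
  `σ ≥ 1 - 4c̄/log(|t|+3)` are `Literature.NumberTheory.LFunctions.ZetaClassicalRegion.exists_zeroFreeRegion_bounds`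
  (`ZetaClassicalRegionBounds.lean`; Titchmarsh Thm. 3.11, (3.11.7)–(3.11.8)); the region of
  `ClassicalPsiData` with `c = 4c̄` sits inside (`MoebiusSum.region_mono`);
* hence `∑_{n ≤ x} (1 + μ(n)) = x + O(x exp(-c'√log x))`, i.e. `⌊x⌋ + M(x) = x + O(…)`, and the
  `O(1)` from `⌊x⌋ - x` is absorbed after shrinking `c'` to `min(c', 1/2)`.

This is the first input of the Möbius–density cancellation (2.4) of Friedlander–Iwaniec,
*Asymptotic sieve for primes* (`Literature.NumberTheory.Sieve.fi_moebius_density_cancellation`,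
`…Sieve/AsymptoticSieveForPrimesInputs`), whose printed proof (pp. 1048–1049) rests on
`∑_{n ≤ w, (n, P(z)) = 1} μ(n)/n ≪ …` "by a standard contour integration".

## References

* H. L. Montgomery, R. C. Vaughan, *Multiplicative Number Theory I*, CUP 2007, §6.2, Theorems 6.7
  and 6.9 [MontgomeryVaughan2007].
* E. C. Titchmarsh, *The Theory of the Riemann Zeta-Function*, 2nd ed. (1986), Theorem 3.11
  [Titchmarsh1986].

## Mathlib search

Mathlib: `riemannZeta₀`, `differentiable_riemannZeta₀`, `riemannZeta_eq_inv_sub_add`,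
`LSeries_one_eq_riemannZeta`, `LSeries_one_mul_Lseries_moebius` (`L(1,s)L(μ,s) = 1`), `LSeries_add`,
`LSeriesSummable_of_bounded_of_one_lt_re`. The tree: `ClassicalPsiData` and
`ClassicalPsiData.abs_psi_sub_le`, `ZetaClassicalRegion.exists_zeroFreeRegion_bounds`,
`MertensBoundRH.zetaInv`, `RH.differentiableAt_zetaInv`. The tree has `M(x)` only under RH
(`MertensBoundRH`, `LittlewoodCriterion`, `RH.mertensFunction`); no unconditional bound for
`∑ μ(n)` beyond `|M(x)| ≤ x` (`lean search 'mertensFunction|sum_moebius|moebius.*exp'`).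
-/

noncomputable section

open Complex Filter Set
open scoped ArithmeticFunction.Moebius

namespace Literature.NumberTheory.LFunctions

namespace MoebiusSum

/-- The region of `ClassicalPsiData` with constant `4c̄` lies inside the region of
`ZetaClassicalRegion.exists_zeroFreeRegion_bounds`. [folklore] -/
theorem region_mono {cbar : ℝ} (hcb : 0 ≤ cbar) {s : ℂ}
    (hs : 1 - 4 * cbar / Real.log (|s.im| + 4) < s.re) :
    1 - 4 * cbar / Real.log (|s.im| + 3) ≤ s.re := by
  have h3 : 1 < Real.log (|s.im| + 3) := ZetaClassicalRegion.one_lt_log_abs_add_three s.im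
  have h34 : Real.log (|s.im| + 3) ≤ Real.log (|s.im| + 4) :=
    Real.log_le_log (by positivity) (by linarith)
  have : 4 * cbar / Real.log (|s.im| + 4) ≤ 4 * cbar / Real.log (|s.im| + 3) :=
    div_le_div_of_nonneg_left (by positivity) (by linarith) h34
  linarith

/-- **The hypotheses of the classical `ψ`-machinery for `Λ'(n) = 1 + μ(n) ≥ 0`**: its Dirichlet
series is `ζ(s) + 1/ζ(s) = 1/(s-1) + F(s)` with `F = ζ₀ + ζ⁻¹` (`ζ₀(s) = ζ(s) - 1/(s-1)` entire,
Mathlib `riemannZeta₀`; `ζ⁻¹` with the removable singularity at `1` filled in,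
`MertensBoundRH.zetaInv`), holomorphic on the classical zero-free region and `≪ log(|t| + 4)` there
by `ZetaClassicalRegion.exists_zeroFreeRegion_bounds` (Titchmarsh (3.11.7)–(3.11.8)).
[cite: MontgomeryVaughan2007, Theorem 6.7] -/
theorem classicalPsiData_one_add_moebius :
    ∃ c C : ℝ, ClassicalPsiData (fun n : ℕ => 1 + (μ n : ℝ))
      (fun s : ℂ => riemannZeta₀ s + MertensBoundRH.zetaInv s) c C := by
  obtain ⟨cbar, hcb0, -, C, hC0, hreg⟩ := ZetaClassicalRegion.exists_zeroFreeRegion_bounds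
  set C' : ℝ := 2 * C + ‖riemannZeta₀ 1‖ with hC'
  have hl4 : 1 ≤ Real.log 4 := by
    rw [← Real.log_exp 1]
    exact Real.log_le_log (Real.exp_pos 1) (by have := Real.exp_one_lt_d9; linarith)
  -- coefficients
  have hcoef : ∀ n : ℕ, 0 ≤ 1 + (μ n : ℝ) := fun n => by
    have : |(μ n : ℝ)| ≤ 1 := by exact_mod_cast ArithmeticFunction.abs_moebius_le_one
    linarith [neg_abs_le (μ n : ℝ)]
  have hsum1 : ∀ s : ℂ, 1 < s.re → LSeriesSummable (1 : ℕ → ℂ) s := fun s hs =>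
    LSeriesSummable_of_bounded_of_one_lt_re (m := 1) (fun n _ => by simp) hs
  have hsumμ : ∀ s : ℂ, 1 < s.re → LSeriesSummable (fun n : ℕ => (μ n : ℂ)) s := fun s hs =>
    LSeriesSummable_of_bounded_of_one_lt_re (m := 1) (fun n _ => by
      rw [Complex.norm_intCast]; exact_mod_cast ArithmeticFunction.abs_moebius_le_one) hs
  have hfun : (fun n : ℕ => (((1 : ℝ) + (μ n : ℝ) : ℝ) : ℂ)) =
      (1 : ℕ → ℂ) + fun n : ℕ => (μ n : ℂ) := by
    funext n
    simp only [Pi.add_apply, Pi.one_apply]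
    push_cast
    ring
  refine ⟨4 * cbar, C', ⟨by positivity, hcoef, fun s hs => ?_, fun s hs => ?_, fun s hs => ?_,
    fun s hs => ?_⟩⟩
  · -- summability
    rw [hfun]
    exact (hsum1 s hs).add (hsumμ s hs)
  · -- the Dirichlet series
    have hs1 : s ≠ 1 := by rintro rfl; simp at hs
    have hμ : LSeries (fun n : ℕ => (μ n : ℂ)) s = (riemannZeta s)⁻¹ := by
      have h := LSeries_one_mul_Lseries_moebius hs
      rw [LSeries_one_eq_riemannZeta hs] at h
      exact eq_inv_of_mul_eq_one_right h
    rw [hfun, LSeries_add (hsum1 s hs) (hsumμ s hs), LSeries_one_eq_riemannZeta hs, hμ,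
      MertensBoundRH.zetaInv_of_ne_one hs1, riemannZeta_eq_inv_sub_add hs1, one_div]
    ring
  · -- holomorphy on the region
    have hζ : s = 1 ∨ riemannZeta s ≠ 0 := by
      by_cases h1 : s = 1
      · exact Or.inl h1
      · exact Or.inr (hreg s h1 (region_mono hcb0.le hs)).1
    exact ((differentiable_riemannZeta₀ s).add
      (LFunctions.differentiableAt_zetaInv hζ)).differentiableWithinAt
  · -- the bound
    have hlog4 : 1 ≤ Real.log (|s.im| + 4) := by
      refine hl4.trans (Real.log_le_log (by norm_num) ?_)
      have := abs_nonneg s.im; linarith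
    by_cases h1 : s = 1
    · subst h1
      simp only [MertensBoundRH.zetaInv, Function.update_self, add_zero]
      calc ‖riemannZeta₀ 1‖ = ‖riemannZeta₀ 1‖ * 1 := (mul_one _).symm
        _ ≤ C' * Real.log (|(1 : ℂ).im| + 4) :=
            mul_le_mul (by rw [hC']; linarith [hC0.le]) hlog4 zero_le_one (by positivity)
    · obtain ⟨-, hsub, hinv, -⟩ := hreg s h1 (region_mono hcb0.le hs)
      have hζ₀ : riemannZeta₀ s = riemannZeta s - 1 / (s - 1) := by
        rw [riemannZeta_eq_inv_sub_add h1, one_div]; ring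
      have h34 : Real.log (|s.im| + 3) ≤ Real.log (|s.im| + 4) :=
        Real.log_le_log (by positivity) (by linarith)
      calc ‖riemannZeta₀ s + MertensBoundRH.zetaInv s‖
          ≤ ‖riemannZeta₀ s‖ + ‖MertensBoundRH.zetaInv s‖ := norm_add_le _ _
        _ ≤ C * Real.log (|s.im| + 3) + C * Real.log (|s.im| + 3) := by
            rw [hζ₀, MertensBoundRH.zetaInv_of_ne_one h1]
            exact add_le_add hsub hinv
        _ ≤ C' * Real.log (|s.im| + 4) := by
            rw [hC']
            nlinarith [norm_nonneg (riemannZeta₀ 1), hC0.le, h34,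
              ZetaClassicalRegion.one_lt_log_abs_add_three s.im]

end MoebiusSum

/-- **`M(x) ≪ x exp(-c√log x)`** (de la Vallée-Poussin's error term for the Möbius sum; Landau,
*Handbuch* §§156–157; Montgomery–Vaughan, Theorem 6.9 analogue for `1/ζ`): there are `c > 0` and
`C` with `|∑_{n ≤ x} μ(n)| ≤ C x exp(-c √log x)` for all `x ≥ 2`. Proof: the classical
`ψ`-machinery of the tree (`ClassicalPsiData.abs_psi_sub_le`, Landau 1903) applied to the
nonnegative sequence `1 + μ(n)`, whose Dirichlet series `ζ + 1/ζ` has the single simple pole at `1`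
with residue `1` and is otherwise controlled in the classical zero-free region
(`MoebiusSum.classicalPsiData_one_add_moebius`); then `∑_{n ≤ x} (1 + μ(n)) = ⌊x⌋ + M(x)`.
[cite: MontgomeryVaughan2007, Theorem 6.9 (6.12)] -/
theorem abs_sum_moebius_le_mul_exp_neg_sqrt_log :
    ∃ c : ℝ, 0 < c ∧ ∃ C : ℝ, ∀ x : ℝ, 2 ≤ x →
      |∑ n ∈ Finset.Ioc 0 ⌊x⌋₊, (μ n : ℝ)| ≤ C * x * Real.exp (-c * Real.sqrt (Real.log x)) := by
  obtain ⟨c, C, h⟩ := MoebiusSum.classicalPsiData_one_add_moebius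
  obtain ⟨c', hc', C', hψ⟩ := h.abs_psi_sub_le
  set c'' : ℝ := min c' (1 / 2) with hc''
  have hc''0 : 0 < c'' := lt_min hc' (by norm_num)
  refine ⟨c'', hc''0, max C' 0 + 1, fun x hx => ?_⟩
  have hx0 : 0 < x := by linarith
  have hx1 : 1 ≤ x := by linarith
  have hmain := hψ x hx
  -- `∑ (1 + μ) = ⌊x⌋ + M(x)`
  have hsplit : ∑ n ∈ Finset.Ioc 0 ⌊x⌋₊, (1 + (μ n : ℝ)) =
      (⌊x⌋₊ : ℝ) + ∑ n ∈ Finset.Ioc 0 ⌊x⌋₊, (μ n : ℝ) := by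
    rw [Finset.sum_add_distrib, Finset.sum_const, Nat.card_Ioc, nsmul_eq_mul, mul_one]
    simp
  rw [hsplit] at hmain
  have hfloor : |(⌊x⌋₊ : ℝ) - x| ≤ 1 := by
    rw [abs_sub_comm, abs_of_nonneg (sub_nonneg.2 (Nat.floor_le hx0.le))]
    exact (sub_lt_iff_lt_add.2 (by linarith [Nat.lt_floor_add_one x])).le
  -- the two exponentials
  set E' : ℝ := Real.exp (-c' * Real.sqrt (Real.log x)) with hE'
  set E'' : ℝ := Real.exp (-c'' * Real.sqrt (Real.log x)) with hE''
  have hEE : E' ≤ E'' := by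
    refine Real.exp_le_exp.2 ?_
    have := Real.sqrt_nonneg (Real.log x)
    nlinarith [min_le_left c' (1 / 2)]
  -- `1 ≤ x E''` since `c'' ≤ 1/2`
  have hxE : 1 ≤ x * E'' := by
    have hL0 : 0 ≤ Real.log x := Real.log_nonneg hx1
    have hc2 : c'' ≤ 1 / 2 := min_le_right _ _
    rcases le_or_gt 1 (Real.log x) with hL1 | hL1
    · -- `√log x ≤ log x`, so `x E'' ≥ x^{1/2} ≥ 1`
      have hsq : Real.sqrt (Real.log x) ≤ Real.log x :=
        Real.sqrt_le_iff.2 ⟨hL0, by nlinarith⟩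
      have h1 : Real.exp (-(Real.log x / 2)) ≤ E'' := by
        refine Real.exp_le_exp.2 ?_
        have := Real.sqrt_nonneg (Real.log x)
        nlinarith
      calc (1 : ℝ) ≤ Real.exp (Real.log x / 2) := Real.one_le_exp (by positivity)
        _ = x * Real.exp (-(Real.log x / 2)) := by
            rw [← Real.exp_log hx0, ← Real.exp_add, Real.exp_log hx0]; ring_nf
        _ ≤ x * E'' := mul_le_mul_of_nonneg_left h1 hx0.le
    · -- `√log x ≤ 1`, so `E'' ≥ e^{-1/2}` and `x E'' ≥ 2 e^{-1/2} ≥ 1`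
      have hsq : Real.sqrt (Real.log x) ≤ 1 := by
        rw [← Real.sqrt_one]; exact Real.sqrt_le_sqrt hL1.le
      have h1 : Real.exp (-(1 / 2 : ℝ)) ≤ E'' := by
        refine Real.exp_le_exp.2 ?_
        have := Real.sqrt_nonneg (Real.log x)
        nlinarith
      have he : Real.exp (1 / 2 : ℝ) ≤ 2 := by
        by_contra hcon
        have h2 : 2 < Real.exp (1 / 2 : ℝ) := not_le.mp hcon
        have : Real.exp 1 = Real.exp (1 / 2 : ℝ) * Real.exp (1 / 2 : ℝ) := by
          rw [← Real.exp_add]; norm_num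
        have h4 : (4 : ℝ) < Real.exp 1 := by rw [this]; nlinarith
        linarith [Real.exp_one_lt_d9]
      calc (1 : ℝ) ≤ 2 * Real.exp (-(1 / 2 : ℝ)) := by
            rw [Real.exp_neg, ← div_eq_mul_inv, le_div_iff₀ (Real.exp_pos _), one_mul]
            exact he
        _ ≤ x * E'' := mul_le_mul hx h1 (Real.exp_pos _).le hx0.le
  -- conclusion
  have hC'0 : C' ≤ max C' 0 := le_max_left _ _
  have hM0 : 0 ≤ max C' 0 := le_max_right _ _
  have hxE' : 0 ≤ x * E' := by positivity
  have key : |(⌊x⌋₊ : ℝ) + ∑ n ∈ Finset.Ioc 0 ⌊x⌋₊, (μ n : ℝ) - x| ≤ max C' 0 * x * E'' :=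
    calc _ ≤ C' * x * E' := hmain
      _ ≤ max C' 0 * x * E' := by
          rw [mul_assoc, mul_assoc]; exact mul_le_mul_of_nonneg_right hC'0 hxE'
      _ ≤ max C' 0 * x * E'' := by
          rw [mul_assoc, mul_assoc]
          exact mul_le_mul_of_nonneg_left (mul_le_mul_of_nonneg_left hEE hx0.le) hM0
  have heq : ∑ n ∈ Finset.Ioc 0 ⌊x⌋₊, (μ n : ℝ) =
      ((⌊x⌋₊ : ℝ) + ∑ n ∈ Finset.Ioc 0 ⌊x⌋₊, (μ n : ℝ) - x) - ((⌊x⌋₊ : ℝ) - x) := by ring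
  rw [heq]
  calc |((⌊x⌋₊ : ℝ) + ∑ n ∈ Finset.Ioc 0 ⌊x⌋₊, (μ n : ℝ) - x) - ((⌊x⌋₊ : ℝ) - x)|
      ≤ |(⌊x⌋₊ : ℝ) + ∑ n ∈ Finset.Ioc 0 ⌊x⌋₊, (μ n : ℝ) - x| + |(⌊x⌋₊ : ℝ) - x| := abs_sub _ _
    _ ≤ max C' 0 * x * E'' + 1 := add_le_add key hfloor
    _ ≤ max C' 0 * x * E'' + x * E'' := by linarith
    _ = (max C' 0 + 1) * x * E'' := by ring

end Literature.NumberTheory.LFunctions
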